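import Summits.BirchSwinnertonDyer.BirchSwinnertonDyer.Theorems.Rank2ObservatoryCosetWitness

/-!
# BirchSwinnertonDyer — rank ≥ 2 observatory: the torsion annihilator `t = gcd_ℓ #E(𝔽_ℓ)`

HONEST FRAMING: per-curve certified theorems and census instruments; no claim on BSD in rank ≥ 2.

The rank-2 certificates never enumerate `E(ℚ)_tors` for the rank claim: they use the integer
`t = gcd_ℓ #E(𝔽_ℓ)` over (up to `25`) good odd primes `ℓ` (field `torsion.gcd_bound`, hypothesis
key `TORSION_INJECTS`), which kills every rational torsion point because reduction modulo a good
prime `ℓ ≥ 3` is injective on torsion (Silverman AEC VII.3.1(b)) and `E(𝔽_ℓ)` is finite. This file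
proves the ALGEBRA of that step for an arbitrary additive commutative group `A` and homomorphisms
`ψ_ℓ : A →+ C_ℓ` into finite groups that are injective on the elements of finite order:

* `addOrderOf_dvd_natCard_of_injOn_torsion` — `addOrderOf x ∣ #C` for `x` of finite order;
* `gcd_card_nsmul_eq_zero_of_injOn_torsion` — `(gcd_ℓ #C_ℓ) • x = 0` for `x` of finite order;
* `two_le_mordellWeilRank_of_certificateWitness` — composed with the coset witness
  (`Rank2ObservatoryCosetWitness.lean`): reductions injective on torsion with `gcd_ℓ #C_ℓ = 2^u m`,
  `m` odd, plus the three coset witnesses for `P₁, P₂, P₁ + P₂`, give `2 ≤ rank_ℤ E(ℚ)` — the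
  certificate's claim (d) `rank E(ℚ) ≥ 2` with exactly its printed data as hypotheses, the
  reduction homomorphisms themselves (not in Mathlib) being the only non-formalised input; and the
  census form `Rank2Row.two_le_mordellWeilRank_of_certificateWitness` for a table row.

References: J. H. Silverman, *The Arithmetic of Elliptic Curves* (2nd ed. 2009), VII.3.1(b);
cell files `code/cert1-engineP/ffcurve.py` (`torsion_gcd_bound`, `good_odd_primes`),
`FACTORY.md § RANK-2 CERTIFICATE`.
-/

-- single-conjunct summit: `Summit.BirchSwinnertonDyer.BirchSwinnertonDyer.…` repeats the name by design
set_option linter.dupNamespace false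

namespace Summit.BirchSwinnertonDyer.BirchSwinnertonDyer.Rank2Observatory

open WeierstrassCurve

section Algebra

variable {A : Type*} [AddCommGroup A]

/-- **Order of a torsion element divides `#C`** when `ψ : A →+ C` is injective on the elements of
finite order and `C` is finite (for `ψ` = reduction modulo a good prime `ℓ ≥ 3`: Silverman AEC
VII.3.1(b), `C = E(𝔽_ℓ)`). [cite: SilvermanAEC2009, VII.3.1(b)] -/
theorem addOrderOf_dvd_natCard_of_injOn_torsion {C : Type*} [AddCommGroup C] [Finite C]
    (ψ : A →+ C) (hinj : Set.InjOn ψ {x : A | IsOfFinAddOrder x}) {x : A}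
    (hx : IsOfFinAddOrder x) : addOrderOf x ∣ Nat.card C := by
  have hdvd : addOrderOf x ∣ addOrderOf (ψ x) := by
    rw [addOrderOf_dvd_iff_nsmul_eq_zero]
    refine hinj (show IsOfFinAddOrder (addOrderOf (ψ x) • x) from hx.nsmul)
      (show IsOfFinAddOrder (0 : A) from IsOfFinAddOrder.zero) ?_
    rw [map_nsmul, map_zero, addOrderOf_nsmul_eq_zero]
  exact hdvd.trans (addOrderOf_dvd_natCard (ψ x))

/-- **The torsion annihilator**: with finitely many homomorphisms `ψ i : A →+ C i` (`i ∈ s`) into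
finite groups, each injective on the elements of finite order, `t = gcd_{i ∈ s} #(C i)` kills every
element of finite order of `A` (certificate field `torsion.gcd_bound`, key `TORSION_INJECTS`).
[cite: SilvermanAEC2009, VII.3.1(b)] -/
theorem gcd_card_nsmul_eq_zero_of_injOn_torsion {ι : Type*} (s : Finset ι) {C : ι → Type*}
    [∀ i, AddCommGroup (C i)] [∀ i, Finite (C i)] (ψ : ∀ i, A →+ C i)
    (hinj : ∀ i ∈ s, Set.InjOn (ψ i) {x : A | IsOfFinAddOrder x}) {x : A}
    (hx : IsOfFinAddOrder x) : (s.gcd fun i => Nat.card (C i)) • x = 0 := by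
  rw [← addOrderOf_dvd_iff_nsmul_eq_zero]
  exact Finset.dvd_gcd fun i hi => addOrderOf_dvd_natCard_of_injOn_torsion (ψ i) (hinj i hi) hx

/-- `ℤ`-scalar form of the torsion annihilator, in the shape `linearIndependent_pair_of_cosetWitness`
consumes: if `gcd_{i ∈ s} #(C i) = 2^u * m` then `(2^u * m) • x = 0` for every `x` of finite order.
[cite: SilvermanAEC2009, VII.3.1(b)] -/
theorem torsion_zsmul_eq_zero_of_injOn_torsion {ι : Type*} (s : Finset ι) {C : ι → Type*}
    [∀ i, AddCommGroup (C i)] [∀ i, Finite (C i)] (ψ : ∀ i, A →+ C i)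
    (hinj : ∀ i ∈ s, Set.InjOn (ψ i) {x : A | IsOfFinAddOrder x}) {u : ℕ} {m : ℤ}
    (ht : ((s.gcd fun i => Nat.card (C i) : ℕ) : ℤ) = (2 : ℤ) ^ u * m) (x : A)
    (hx : IsOfFinAddOrder x) : ((2 : ℤ) ^ u * m) • x = 0 := by
  rw [← ht, natCast_zsmul]
  exact gcd_card_nsmul_eq_zero_of_injOn_torsion s ψ hinj hx

end Algebra

/-! ### The certificate's claim (d): `rank E(ℚ) ≥ 2` from its printed data -/

/-- **Certificate claim (d) ⇒ `rank_ℤ E(ℚ) ≥ 2`.** Given homomorphisms `ψ i : E(ℚ) →+ C i`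
(`i ∈ s`; reductions modulo the certificate's good odd primes `ℓ`) into finite groups, injective on
torsion (Silverman AEC VII.3.1(b)), with `gcd_{i ∈ s} #(C i) = 2^u m`, `m` odd (field
`torsion.gcd_bound = t`), and three homomorphisms `φ₁, φ₂, φ₃` (reductions modulo the witness primes)
with `φ₁ P₁`, `φ₂ P₂`, `φ₃ (P₁ + P₂)` outside `2B + B[2^u]` (field `rank_lower.v2_witnesses`), the
points `P₁, P₂` are independent and `2 ≤ rank_ℤ E(ℚ)` (Mordell–Weil proved in the tree).
[cite: SilvermanAEC2009, VII.3.1(b)] [cite: SilvermanAEC2009, Thm. VIII.6.7] -/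
theorem two_le_mordellWeilRank_of_certificateWitness (W : WeierstrassCurve ℚ) [W.IsElliptic]
    {ι : Type*} (s : Finset ι) {C : ι → Type*} [∀ i, AddCommGroup (C i)] [∀ i, Finite (C i)]
    (ψ : ∀ i, W.toAffine.Point →+ C i)
    (hinj : ∀ i ∈ s, Set.InjOn (ψ i) {x : W.toAffine.Point | IsOfFinAddOrder x}) {u : ℕ} {m : ℤ}
    (hm : Odd m) (ht : ((s.gcd fun i => Nat.card (C i) : ℕ) : ℤ) = (2 : ℤ) ^ u * m)
    {B₁ B₂ B₃ : Type*} [AddCommGroup B₁] [AddCommGroup B₂] [AddCommGroup B₃]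
    {P₁ P₂ : W.toAffine.Point} (φ₁ : W.toAffine.Point →+ B₁) (φ₂ : W.toAffine.Point →+ B₂)
    (φ₃ : W.toAffine.Point →+ B₃) (h₁ : φ₁ P₁ ∉ twoCoset B₁ u) (h₂ : φ₂ P₂ ∉ twoCoset B₂ u)
    (h₃ : φ₃ (P₁ + P₂) ∉ twoCoset B₃ u) : 2 ≤ W.mordellWeilRank :=
  two_le_mordellWeilRank_of_cosetWitness W hm
    (torsion_zsmul_eq_zero_of_injOn_torsion s ψ hinj ht) φ₁ φ₂ φ₃ h₁ h₂ h₃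

/-- **Census form of claim (d)** for a row of the rank-2 table (`check = true`; generators
`gen₁, gen₂`): the certificate's torsion bound and coset witnesses give the named hypothesis
`hlow : 2 ≤ rank_ℤ E(ℚ)` of the row theorems. [cite: SilvermanAEC2009, VII.3.1(b)] -/
theorem Rank2Row.two_le_mordellWeilRank_of_certificateWitness (r : Rank2Row) (h : r.check = true)
    {ι : Type*} (s : Finset ι) {C : ι → Type*} [∀ i, AddCommGroup (C i)] [∀ i, Finite (C i)]
    (ψ : ∀ i, r.curve.toAffine.Point →+ C i)
    (hinj : ∀ i ∈ s, Set.InjOn (ψ i) {x : r.curve.toAffine.Point | IsOfFinAddOrder x}) {u : ℕ}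
    {m : ℤ} (hm : Odd m) (ht : ((s.gcd fun i => Nat.card (C i) : ℕ) : ℤ) = (2 : ℤ) ^ u * m)
    {B₁ B₂ B₃ : Type*} [AddCommGroup B₁] [AddCommGroup B₂] [AddCommGroup B₃]
    (φ₁ : r.curve.toAffine.Point →+ B₁) (φ₂ : r.curve.toAffine.Point →+ B₂)
    (φ₃ : r.curve.toAffine.Point →+ B₃) (h₁ : φ₁ (r.gen₁ h) ∉ twoCoset B₁ u)
    (h₂ : φ₂ (r.gen₂ h) ∉ twoCoset B₂ u) (h₃ : φ₃ (r.gen₁ h + r.gen₂ h) ∉ twoCoset B₃ u) :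
    2 ≤ r.curve.mordellWeilRank :=
  r.two_le_mordellWeilRank_of_cosetWitness h hm (torsion_zsmul_eq_zero_of_injOn_torsion s ψ hinj ht)
    φ₁ φ₂ φ₃ h₁ h₂ h₃

end Summit.BirchSwinnertonDyer.BirchSwinnertonDyer.Rank2Observatory
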